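import Mathlib
import HarnessLib
import Summits.HubbardSuperconductivity.HubbardSuperconductivity.Theorems.KLProgrammeC4aCoMovingIntegral
import Summits.HubbardSuperconductivity.HubbardSuperconductivity.Theorems.KLProgrammeKLRegimeCountertermGridReading

/-!
# Route `KLProgramme` — crux C4a (inductive tangential bound), (L2)-continuum preliminaries: periodicity of the co-moving chart,
# the shift identity of co-moving jets, global smoothness by support, constant dominators on the tube, smoothness of tube integrals

Cell `gate-hubbard-kl`, lane hubbard-kl-c4a-1 (g2); helper for the engine-flow child `KLRegimeEngineV17F2`
(stmt-HubbardSuperconductivity-20437), stub (C) `stub_twoLeg_curvature` (memo HOME/hubbard-kl-c4a-1/C4A-PLAN.md §2c, §6 (L2), §9).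
The layers under the TADPOLE-JET theorem (`…C4aTadpoleJets`, next file), separated to keep both files short:

* §1 `levelPoint_periodic` (the chart `Φ = levelPoint μ K` is `2π`-periodic in the angle, from `klFermiPoint_periodic`) and
  `iteratedDeriv_coMoving_base_zero`: the `i`-th jet at time `θ` of `coMoving μ K V 0 ρ ϑ` is the `i`-th jet at time `0` of
  `coMoving μ K V θ ρ (ϑ + θ)` (base angles shifted along — `coMoving_add`);
* §2 `contDiff_of_contDiffOn_of_eventuallyEq_zero`: `Cⁿ` on an open set and locally zero off it ⇒ `Cⁿ` (how a slice profile supported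
  inside the tube makes the tadpole integrand globally smooth although the chart is only smooth on the tube);
* §3 `exists_const_dom_tube`: a jointly `C^∞` tube integrand, `T`-periodic in the external and in the loop angle and vanishing for
  `|ρ| ≥ r`, has every co-moving jet `∂_θᵐ Ψ(θ, (ρ, ϑ + θ))` bounded by a constant (compact fundamental domain) — the qualitative
  domination hypothesis `hdom` of `norm_iteratedDeriv_tube_integral_le` (…C4aCoMovingIntegral §4), at every order, for free;
* §4 `contDiff_tube_integral`: under the hypotheses of `norm_iteratedDeriv_tube_integral_le` the tube integral is `C^∞` in the external
  angle (the regularity conjunct of `TwoLegCurveJetBound`).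

Pure analysis; nothing is asserted about the Hubbard model.  References: FST II CPAM 51 (1998) 1133 Thm 3.5; Hörmander ALPDO I
Thm 1.1.9 [folklore]; BGM 2006 §2.4 [cite: BenfattoGiulianiMastropietro2006].
-/

noncomputable section

namespace Summit.HubbardSuperconductivity.HubbardSuperconductivity.Theorems.C4a

set_option linter.dupNamespace false -- summit = problem name (single-conjunct summit), D-0017

open Real Set MeasureTheory Filter
open scoped ContDiff Topology
open Literature.Analysis.Calculus
open Literature.MathematicalPhysics.QuantumLattice
open Summit.HubbardSuperconductivity.HubbardSuperconductivity.Theorems.KLRegimeSplit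

/-! ## §1 The chart is periodic in the angle; co-moving jets at time `θ` are jets at time `0` with shifted base angles -/

/-- `levelPoint μ K ρ` is `2π`-periodic in the angle. -/
theorem levelPoint_periodic (μ : ℝ) (K : TrigPolyC4v) (ρ : ℝ) : Function.Periodic (levelPoint μ K ρ) (2 * π) := fun ϑ => by
  simp only [levelPoint, klFermiPoint_periodic (μ + ρ) K ϑ]

/-- **Shift identity**: the `i`-th jet at time `θ` of the co-moving reading with base angles `(0, ϑ)` is the `i`-th jet at time `0`
with base angles `(θ, ϑ + θ)`. -/
theorem iteratedDeriv_coMoving_base_zero (μ : ℝ) (K : TrigPolyC4v) (V : Momentum → Momentum → ℂ) (ρ ϑ θ : ℝ) (i : ℕ) :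
    iteratedDeriv i (coMoving μ K V 0 ρ ϑ) θ = iteratedDeriv i (coMoving μ K V θ ρ (ϑ + θ)) 0 := by
  have hfun : coMoving μ K V 0 ρ ϑ = fun s => coMoving μ K V θ ρ (ϑ + θ) (s - θ) := by
    funext s
    rw [show coMoving μ K V θ ρ (ϑ + θ) (s - θ) = coMoving μ K V (0 + θ) ρ (ϑ + θ) (s - θ) by rw [zero_add],
      ← coMoving_add]
    congr 1; ring
  rw [hfun, iteratedDeriv_comp_sub_const]
  simp only [sub_self]

/-! ## §2 Global smoothness from smoothness on an open set off which the function vanishes locally -/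

/-- A function `Cⁿ` on an open set `U` and locally zero at every point outside `U` is `Cⁿ` everywhere. -/
theorem contDiff_of_contDiffOn_of_eventuallyEq_zero {E F : Type*} [NormedAddCommGroup E] [NormedSpace ℝ E]
    [NormedAddCommGroup F] [NormedSpace ℝ F] {Ψ : E → F} {U : Set E} {n : WithTop ℕ∞} (hU : IsOpen U)
    (hΨ : ContDiffOn ℝ n Ψ U) (hzero : ∀ x ∉ U, Ψ =ᶠ[𝓝 x] 0) : ContDiff ℝ n Ψ := by
  rw [contDiff_iff_contDiffAt]
  intro x
  by_cases hx : x ∈ U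
  · exact hΨ.contDiffAt (hU.mem_nhds hx)
  · exact (contDiffAt_const (c := (0 : F))).congr_of_eventuallyEq (hzero x hx)

/-! ## §3 Qualitative domination of every co-moving jet on the tube (compactness + double periodicity) -/

section Dom

variable {F : Type*} [NormedAddCommGroup F] [NormedSpace ℝ F]

/-- **Every co-moving jet of a doubly periodic smooth tube integrand vanishing off the tube is bounded by a constant.**
`Ψ : ℝ × (ℝ × ℝ) → F` jointly `C^∞`, `T`-periodic in the external angle `θ` and in the loop angle `ϑ`, and identically zero for
`|ρ| ≥ r`; then for every order `m` there is `C` with `‖∂_θᵐ Ψ(θ, (ρ, ϑ + θ))‖ ≤ C` for all `θ, ρ, ϑ` — a constant dominator,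
integrable on the bounded tube (the hypothesis `hdom` of `norm_iteratedDeriv_tube_integral_le`). -/
theorem exists_const_dom_tube {Ψ : ℝ × (ℝ × ℝ) → F} (hΨ : ContDiff ℝ ∞ Ψ) {r T : ℝ} (hT : 0 < T)
    (hperθ : ∀ a : ℝ × ℝ, Function.Periodic (fun θ => Ψ (θ, a)) T)
    (hperϑ : ∀ θ ρ, Function.Periodic (fun ϑ => Ψ (θ, (ρ, ϑ))) T)
    (hzero : ∀ θ ρ ϑ, r ≤ |ρ| → Ψ (θ, (ρ, ϑ)) = 0) (m : ℕ) :
    ∃ C : ℝ, 0 ≤ C ∧ ∀ (a : ℝ × ℝ) (θ : ℝ), ‖iteratedDeriv m (fun θ : ℝ => Ψ (θ, (a.1, a.2 + θ))) θ‖ ≤ C := by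
  set L : ℝ →L[ℝ] ℝ × (ℝ × ℝ) :=
    (ContinuousLinearMap.id ℝ ℝ).prod ((0 : ℝ →L[ℝ] ℝ).prod (ContinuousLinearMap.id ℝ ℝ)) with hL
  -- the jet as a jointly continuous function of (a, θ)
  set D : (ℝ × ℝ) × ℝ → F := fun q => iteratedDeriv m (fun θ : ℝ => Ψ (θ, (q.1.1, q.1.2 + θ))) q.2 with hD
  have hc : Continuous fun a : ℝ × ℝ => ((0 : ℝ), (a.1, a.2)) := continuous_const.prodMk (continuous_fst.prodMk continuous_snd)
  have hDcont : Continuous D := by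
    have hcont := continuous_iteratedFDeriv_comp_affine (C := ℝ × ℝ) hΨ L hc m
    have heq : D = fun q : (ℝ × ℝ) × ℝ =>
        (ContinuousMultilinearMap.piFieldEquiv ℝ (Fin m) F).symm
          (iteratedFDeriv ℝ m (fun θ : ℝ => Ψ (L θ + ((0 : ℝ), (q.1.1, q.1.2)))) q.2) := by
      funext q
      rw [hD]
      simp only
      rw [coMoving_tube_integrand_eq_affine Ψ q.1, iteratedDeriv_eq_equiv_comp]
      rfl
    rw [heq]
    exact (ContinuousMultilinearMap.piFieldEquiv ℝ (Fin m) F).symm.continuous.comp hcont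
  -- periodicity in the loop angle
  have hDperϑ : ∀ ρ θ, Function.Periodic (fun ϑ => D ((ρ, ϑ), θ)) T := by
    intro ρ θ ϑ
    simp only [hD]
    congr 1
    funext θ'
    have := hperϑ θ' ρ (ϑ + θ')
    rw [show ϑ + T + θ' = ϑ + θ' + T by ring]
    exact this
  -- periodicity in the external angle
  have hDperθ : ∀ a : ℝ × ℝ, Function.Periodic (fun θ => D (a, θ)) T := by
    intro a θ
    simp only [hD]
    have hF : (fun z : ℝ => (fun θ' : ℝ => Ψ (θ', (a.1, a.2 + θ'))) (z + T)) = fun θ' : ℝ => Ψ (θ', (a.1, a.2 + θ')) := by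
      funext z
      have h1 := hperϑ (z + T) a.1 (a.2 + z)
      have h2 := hperθ (a.1, a.2 + z) z
      show Ψ (z + T, (a.1, a.2 + (z + T))) = Ψ (z, (a.1, a.2 + z))
      rw [show a.2 + (z + T) = a.2 + z + T by ring]
      exact h1.trans h2
    have key := congrFun (iteratedDeriv_comp_add_const m (fun θ' : ℝ => Ψ (θ', (a.1, a.2 + θ'))) T) θ
    rw [hF] at key
    exact key.symm
  -- vanishing off the tube
  have hDzero : ∀ (a : ℝ × ℝ) (θ : ℝ), r ≤ |a.1| → D (a, θ) = 0 := by
    intro a θ ha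
    simp only [hD]
    have : (fun θ' : ℝ => Ψ (θ', (a.1, a.2 + θ'))) = fun _ => (0 : F) := funext fun θ' => hzero θ' a.1 _ ha
    rw [this, iteratedDeriv_const]
    simp
  -- bounded on the compact fundamental domain, hence everywhere
  obtain ⟨C, hC⟩ : ∃ C, ∀ y ∈ D '' (((Icc (-r) r) ×ˢ (Icc 0 T)) ×ˢ (Icc 0 T)), ‖y‖ ≤ C :=
    (((isCompact_Icc.prod isCompact_Icc).prod isCompact_Icc).image_of_continuousOn
      hDcont.continuousOn).isBounded.exists_norm_le
  refine ⟨max C 0, le_max_right _ _, fun a θ => ?_⟩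
  show ‖D (a, θ)‖ ≤ max C 0
  by_cases ha : r ≤ |a.1|
  · rw [hDzero a θ ha, norm_zero]; exact le_max_right _ _
  · have hρ : a.1 ∈ Icc (-r) r := by
      rw [not_le, abs_lt] at ha; exact ⟨ha.1.le, ha.2.le⟩
    obtain ⟨ϑ₀, hϑ₀, h1⟩ := (hDperϑ a.1 θ).exists_mem_Ico₀ hT a.2
    obtain ⟨θ₀, hθ₀, h2⟩ := (hDperθ (a.1, ϑ₀)).exists_mem_Ico₀ hT θ
    have h1' : D (a, θ) = D ((a.1, ϑ₀), θ) := h1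
    have h2' : D ((a.1, ϑ₀), θ) = D ((a.1, ϑ₀), θ₀) := h2
    rw [h1', h2']
    exact (hC _ (mem_image_of_mem D (mk_mem_prod (mk_mem_prod hρ (Ico_subset_Icc_self hϑ₀))
      (Ico_subset_Icc_self hθ₀)))).trans (le_max_left _ _)

end Dom


/-! ## §4 The tube integral is smooth (companion of `norm_iteratedDeriv_tube_integral_le`) -/

section TubeSmooth

variable {F : Type*} [NormedAddCommGroup F] [NormedSpace ℝ F] [CompleteSpace F]

/-- **The tube integral is `C^∞` in the external angle**: `Ψ` jointly `C^∞`, `T`-periodic in the loop angle, with co-moving jets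
dominated at every order on the tube ⇒ `θ ↦ ∫_{tube} Ψ(θ, a) da` is `C^∞` (differentiation under the integral in the co-moving form). -/
theorem contDiff_tube_integral {Ψ : ℝ × (ℝ × ℝ) → F} (hΨ : ContDiff ℝ ∞ Ψ) {r T : ℝ} (hT : 0 < T)
    (hper : ∀ θ ρ, Function.Periodic (fun ϑ => Ψ (θ, (ρ, ϑ))) T)
    (hdom : ∀ m : ℕ, ∃ g : ℝ × ℝ → ℝ, IntegrableOn g (Ioo (-r) r ×ˢ Ioc 0 T) ∧
      ∀ a θ, ‖iteratedDeriv m (fun θ : ℝ => Ψ (θ, (a.1, a.2 + θ))) θ‖ ≤ g a) :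
    ContDiff ℝ ∞ (fun θ : ℝ => ∫ a in Ioo (-r) r ×ˢ Ioc 0 T, Ψ (θ, a)) := by
  set S : Set (ℝ × ℝ) := Ioo (-r) r ×ˢ Ioc 0 T with hS
  set μ : Measure (ℝ × ℝ) := volume.restrict S with hμ
  set H : ℝ × ℝ → ℝ → F := fun a θ => Ψ (θ, (a.1, a.2 + θ)) with hH
  have hfun : (fun θ : ℝ => ∫ a in S, Ψ (θ, a)) = fun θ => ∫ a, H a θ ∂μ := by
    funext θ'
    exact setIntegral_tube_eq_coMoving hΨ.continuous hT hper θ'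
  set L : ℝ →L[ℝ] ℝ × (ℝ × ℝ) := (ContinuousLinearMap.id ℝ ℝ).prod ((0 : ℝ →L[ℝ] ℝ).prod (ContinuousLinearMap.id ℝ ℝ)) with hL
  have hHaff : ∀ a, H a = fun θ : ℝ => Ψ (L θ + ((0 : ℝ), (a.1, a.2))) := fun a => coMoving_tube_integrand_eq_affine Ψ a
  have h1 : ∀ a, ContDiff ℝ ∞ (H a) := by
    intro a; rw [hHaff a]; exact hΨ.comp ((L.contDiff).add contDiff_const)
  have h2 : ∀ (m : ℕ) (p : ℝ), AEStronglyMeasurable (fun a => iteratedFDeriv ℝ m (H a) p) μ := by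
    intro m p
    have hc : Continuous fun a : ℝ × ℝ => ((0 : ℝ), (a.1, a.2)) := continuous_const.prodMk (continuous_fst.prodMk continuous_snd)
    have hcont := continuous_iteratedFDeriv_comp_affine_param (C := ℝ × ℝ) hΨ L hc m p
    have heq : (fun a => iteratedFDeriv ℝ m (H a) p) =
        fun a : ℝ × ℝ => iteratedFDeriv ℝ m (fun θ : ℝ => Ψ (L θ + ((0 : ℝ), (a.1, a.2)))) p := by
      funext a; rw [hHaff a]
    rw [heq]
    exact hcont.aestronglyMeasurable
  have h3 : ∀ m : ℕ, ∃ g : ℝ × ℝ → ℝ, Integrable g μ ∧ ∀ a p, ‖iteratedFDeriv ℝ m (H a) p‖ ≤ g a := by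
    intro m
    obtain ⟨g', hg', hb'⟩ := hdom m
    exact ⟨g', hg', fun a p => by rw [norm_iteratedFDeriv_eq_norm_iteratedDeriv]; exact hb' a p⟩
  rw [hfun]
  exact contDiff_integral_of_dominated_iteratedFDeriv (μ := μ) h1 h2 h3

end TubeSmooth

end Summit.HubbardSuperconductivity.HubbardSuperconductivity.Theorems.C4a
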